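import Literature.IUT.HodgeArakelov.MonoThetaProjectiveProp16Proofs
import Literature.AnabelianGeometry.EtaleTheta.TemperedCoverings

/-!
# [IUTchII] Prop. 1.6 (i): the content of the typed core output in the tree's vocabulary
# `EtaleTheta.IsTopCharacteristic` (proof-only companion, dictionary)

PROOF-ONLY companion (theorems only; no `def`, no new named fact) of abc-iut-L6-t1's frozen
`MonoThetaProjective.lean` (p407497) and of the inhabitant/consistency file
`MonoThetaProjectiveProp16Proofs.lean` (abc-iut-w5-d030, p412824). abc-iut cell, wave-5 seat
abc-iut-w5-d030; DAG node **IUTchII:Prop1.6(i)** (layer L6, outside the [IUTchIII] Cor. 3.12 cone).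
S. Mochizuki, *Inter-universal Teichmüller theory II*, kurims manuscript (Dec. 2020), §1, Prop. 1.6,
p. 31 l. 10–12: "Write `Δ ⊆ Π` for the [group-theoretic! — cf., e.g., [AbsAnab], Lemma 1.3.8] subgroup
corresponding to `Δ^tp_{X̲̲_k}`." [claim: Mochizuki2012, status: disputed] (IUTchII §1 Prop 1.6, kurims p.31).

## What is proved (dictionary only)

`MonoThetaProjectiveProp16Proofs` shows that the typed Prop. 1.6 (i) OUTPUT `CoreData S P` is inhabited
exactly when `P ≅ Π^tp_{X̲̲_k}` and `Δ^tp_{X̲̲_k}` is stable under every topological automorphism of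
`Π^tp_{X̲̲_k}`, the latter spelled out as `∀ φ : S.PiX ≃ₜ* S.PiX, S.DeltaX.map φ = S.DeltaX`. That
condition IS the tree's notion `Literature.AnabelianGeometry.EtaleTheta.IsTopCharacteristic` ([EtTh]
Def. 3.3 (i) vocabulary, abc-iut-L2; the same predicate in which the [IUTchII] §2 merge files
`BadPlaceSettingOfDoubleUnderline`, `TemperedCoveringsCharacteristic` state their tempered-anabelian
inputs (H1)). This file records the identification so that consumers at the MERGE (HOME/plan/L6/MERGE-MAP.md
row 91) grep ONE predicate:

* `CoreData.isTopCharacteristic_deltaX` — a `CoreData S P` forces `IsTopCharacteristic S.PiX S.DeltaX`;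
* `CoreData.nonempty_iff_isTopCharacteristic` —
  `Nonempty (CoreData S P) ↔ Nonempty (P ≃ₜ* S.PiX) ∧ IsTopCharacteristic S.PiX S.DeltaX`;
* `CoreData.nonempty_of_isTopCharacteristic` — the "if" direction as a usable lemma.

HONEST FRAMING: the claim key `Mochizuki2012` is DISPUTED (D-0012); the characteristic-subgroup
condition is the printed [AbsAnab] Lem. 1.3.8 INPUT (not proved here, nor assumed as a `def`); nothing
here takes a side on [IUTchIII] Cor. 3.12; typed ≠ discharged elsewhere.
-/

namespace Literature.IUT.HodgeArakelov

universe u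

open Literature.AnabelianGeometry.EtaleTheta

variable {S : ThetaSetting.{u}} {P : TopGroup.{u}}

namespace CoreData

/-- A typed Prop. 1.6 (i) output forces `Δ^tp_{X̲̲_k}` to be characteristic in the topological group
`Π^tp_{X̲̲_k}` in the sense of the tree's `EtaleTheta.IsTopCharacteristic` (the printed "[group-theoretic! —
cf., e.g., [AbsAnab], Lemma 1.3.8]" input). [claim: Mochizuki2012, status: disputed] (IUTchII §1 Prop 1.6 (i), kurims p.31) -/
theorem isTopCharacteristic_deltaX (C : CoreData S P) : IsTopCharacteristic S.PiX S.DeltaX :=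
  fun φ => deltaX_map_eq_of_coreData C φ

/-- **Exact content of the typed Prop. 1.6 (i) output, in the tree's vocabulary**:
`CoreData S P` is inhabited iff `P ≅ Π^tp_{X̲̲_k}` as topological groups and `Δ^tp_{X̲̲_k}` is
`IsTopCharacteristic` in `Π^tp_{X̲̲_k}`. [claim: Mochizuki2012, status: disputed] (IUTchII §1 Prop 1.6 (i), kurims p.31) -/
theorem nonempty_iff_isTopCharacteristic :
    Nonempty (CoreData S P) ↔ Nonempty (P ≃ₜ* S.PiX) ∧ IsTopCharacteristic S.PiX S.DeltaX :=
  nonempty_iff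

/-- The "if" direction as a lemma: a reference isomorphism together with the [AbsAnab] Lem. 1.3.8 input
(`IsTopCharacteristic S.PiX S.DeltaX`) inhabits the typed Prop. 1.6 (i) output over `P`.
[claim: Mochizuki2012, status: disputed] (IUTchII §1 Prop 1.6 (i), kurims p.31) -/
theorem nonempty_of_isTopCharacteristic (e : P ≃ₜ* S.PiX)
    (hΔ : IsTopCharacteristic S.PiX S.DeltaX) : Nonempty (CoreData S P) :=
  nonempty_iff_isTopCharacteristic.2 ⟨⟨e⟩, hΔ⟩

end CoreData

end Literature.IUT.HodgeArakelov
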